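import Literature.Analysis.FluidPDE.CheskidovShvydkoyAssembly
import Literature.Analysis.FluidPDE.LerayLocalRegularH1Proofs
import HarnessLib

/-!
# Discharge of `cheskidov_shvydkoy` (ns.S31; Cheskidov–Shvydkoy 2010, Thm. 3.1)

Analysis/FluidPDE proof file (no definitions, no named facts, no statement changed), serving the
named fact `Literature.Analysis.FluidPDE.cheskidov_shvydkoy` of `CriticalRegularity.lean`
(A. Cheskidov, R. Shvydkoy, *The regularity of weak solutions of the 3D Navier–Stokes equations
in `B^{-1}_{∞,∞}`*, Arch. Ration. Mech. Anal. 195 (2010) 159–169 = arXiv:0708.3067, Thm. 3.1,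
p. 5: "Let `u(t)` be a Leray–Hopf solution of (NSE) on `[0,T]`. If `u(t)` satisfies
`sup_{t ∈ (0,T]} limsup_{t₀ → t⁻} ‖u(t) - u(t₀)‖_{B^{-1}_{∞,∞}} < cν`, where `c > 0` is some
absolute constant, then `u(t)` is regular on `(0,T]`").

Everything is already proved in the tree; this file only composes the accepted theorems:

* **Lemma 3.2** (p. 5; the named fact `cheskidov_shvydkoy_dyadic_regular` of
  `CheskidovShvydkoyRegular.lean`, `H¹` form) is `cheskidov_shvydkoy_dyadic_regular_of_local_regular`
  (`CheskidovShvydkoyAssembly.lean`: the frequency-localised enstrophy estimate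
  `IsSmoothSlabSolution.dyadicF_le_exp` of `CheskidovShvydkoyApriori.lean` bootstrapped along
  intervals of regularity) applied to the discharged local regular `H¹` theory
  `leray_local_regular_H1_holds` (`LerayLocalRegularH1Proofs.lean`; Leray 1934, §§19–24, through
  Tao 2013, Thm. 5.4 / Prop. 5.6, `tao2011_H1_local_almost_regular_holds`);
* **Thm. 2.4** ("Leray", `s = 1`) and the passage from "regular" to a classical representative
  (ns.S07) are `leray_continuation_H1_holds` and `ladyzhenskaya_prodi_serrin_holds`
  (`CheskidovShvydkoyRegularProofs.lean`), packaged with the printed proof of Thm. 3.1 (p. 6) in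
  `cheskidov_shvydkoy_of_dyadic_regular`.

Discharged here: `cheskidov_shvydkoy_dyadic_regular` (Lemma 3.2 as printed),
`cheskidov_shvydkoy_dyadic` (its house form), `cheskidov_shvydkoy_small` (Cor. 3.3),
`cheskidov_shvydkoy_inhom` (Thm. 3.1 as printed, inhomogeneous `B^{-1}_{∞,∞}`) and
`cheskidov_shvydkoy` (ns.S31, homogeneous rendering).

## References

* A. Cheskidov, R. Shvydkoy, Arch. Ration. Mech. Anal. 195 (2010) 159–169 = arXiv:0708.3067:
  Thm. 3.1 and Lemma 3.2 (p. 5), Cor. 3.3 and the proof of Thm. 3.1 (p. 6), Thm. 2.4 (p. 4).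
  [CheskidovShvydkoy2010]
-/

noncomputable section

namespace Literature.Analysis.FluidPDE

/-- **Cheskidov–Shvydkoy 2010, Lemma 3.2, discharged** (arXiv:0708.3067, p. 5: "Let `u(t)` be a
Leray–Hopf solution of (NSE) on `[0,T]`. There is a constant `c > 0` such that if
`limsup_{q → ∞} sup_{t ∈ (0,T)} λ_q⁻¹ ‖u_q(t)‖_∞ < cν`, then `u(t)` is regular on `(0,T]`", with
"regular" = `‖u(t)‖_{H¹}` continuous): the accepted
`cheskidov_shvydkoy_dyadic_regular_of_local_regular` applied to `leray_local_regular_H1_holds`.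
[cite: CheskidovShvydkoy2010, Lemma 3.2] -/
theorem cheskidov_shvydkoy_dyadic_regular_holds : cheskidov_shvydkoy_dyadic_regular :=
  cheskidov_shvydkoy_dyadic_regular_of_local_regular leray_local_regular_H1_holds

/-- **Lemma 3.2 in the house form** (`cheskidov_shvydkoy_dyadic`: classical representative on
`Ioc 0 T`), discharged through `cheskidov_shvydkoy_dyadic_of_regular` and ns.S07
(`ladyzhenskaya_prodi_serrin_holds`). [cite: CheskidovShvydkoy2010, Lemma 3.2] -/
theorem cheskidov_shvydkoy_dyadic_holds : cheskidov_shvydkoy_dyadic :=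
  cheskidov_shvydkoy_dyadic_of_regular cheskidov_shvydkoy_dyadic_regular_holds
    ladyzhenskaya_prodi_serrin_holds

/-- **Cheskidov–Shvydkoy 2010, Cor. 3.3, discharged** (p. 6: `‖u‖_{L^∞((0,T); B^{-1}_{∞,∞})} < cν`
implies regularity on `(0, T]`), through the accepted `cheskidov_shvydkoy_small_of_dyadic`.
[cite: CheskidovShvydkoy2010, Cor. 3.3] -/
theorem cheskidov_shvydkoy_small_holds : cheskidov_shvydkoy_small :=
  cheskidov_shvydkoy_small_of_dyadic cheskidov_shvydkoy_dyadic_holds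

/-- **Cheskidov–Shvydkoy 2010, Thm. 3.1 as printed (inhomogeneous `B^{-1}_{∞,∞}`), discharged**:
the printed proof (p. 6) assembled in the accepted `cheskidov_shvydkoy_inhom_of_regular`, fed with
Lemma 3.2 (`cheskidov_shvydkoy_dyadic_regular_holds`), Thm. 2.4 (`leray_continuation_H1_holds`)
and ns.S07 (`ladyzhenskaya_prodi_serrin_holds`). [cite: CheskidovShvydkoy2010, Thm. 3.1] -/
theorem cheskidov_shvydkoy_inhom_holds : cheskidov_shvydkoy_inhom :=
  cheskidov_shvydkoy_inhom_of_regular cheskidov_shvydkoy_dyadic_regular_holds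
    leray_continuation_H1_holds ladyzhenskaya_prodi_serrin_holds

/-- **ns.S31 — Cheskidov–Shvydkoy's regularity criterion in the largest critical space
`B^{-1}_{∞,∞}`, discharged** (Arch. Ration. Mech. Anal. 195 (2010), Thm. 3.1: a Leray–Hopf weak
solution of the unforced Navier–Stokes equations on `ℝ³ × [0, T)` whose left jumps in
`Ḃ^{-1}_{∞,∞}` are uniformly smaller than `cν` on `(0, T]` has a classical representative on the
time set `Ioc 0 T`). Proof: the accepted `cheskidov_shvydkoy_of_dyadic_regular` (Thm. 3.1 from
Lemma 3.2, with Thm. 2.4 and ns.S07 discharged in `CheskidovShvydkoyRegularProofs.lean`, and the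
comparison of the homogeneous and inhomogeneous norms of `L²` increments,
`cheskidov_shvydkoy_of_inhom`) applied to `cheskidov_shvydkoy_dyadic_regular_holds`.
[cite: CheskidovShvydkoy2010, Thm. 3.1] -/
theorem cheskidov_shvydkoy_holds : cheskidov_shvydkoy :=
  cheskidov_shvydkoy_of_dyadic_regular cheskidov_shvydkoy_dyadic_regular_holds

end Literature.Analysis.FluidPDE

end
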